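import Mathlib
import Literature.NumberTheory.Automorphic.HilbertModularFormQExpansion
import Summits.Langlands.Langlands.Theorems.CapacityClassicalityHilbertIntegralOverconvergentIsCongruenceStubDualLatticeEquiv
import Summits.Langlands.Langlands.Theorems.CapacityClassicalityHilbertIntegralOverconvergentIsCongruenceStubTotallyRealEmbeddings

/-!
# Finiteness of the antidiagonal of the `q`-expansion cone

Stub `stub_finite_qIndex_antidiagonal` (O1) for line Sketch-ideate-r1-k1 of the crux
`HilbertIntegralOverconvergentIsCongruence` (stmt-Langlands-8485).  Section O of the line builds the
`q`-expansion dictionary for Hilbert modular forms over a totally real field `F`: Fourier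
coefficients are indexed by the cone `qIndexSet F` (elements of the dual lattice
`𝔡⁻¹ = {ν : Tr(ν a) ∈ ℤ ∀ a ∈ 𝓞 F}` that are `0` or totally positive) and multiply by the finite
convolution `a_ν(fg) = ∑_{μ + μ' = ν} a_μ(f) a_{μ'}(g)`.  This file proves that the antidiagonal
`{(μ, μ') ∈ qIndexSet F × qIndexSet F : μ + μ' = ν}` is finite.

Proof.  Cone elements are totally non-negative, so both components of a pair on the antidiagonal
lie in the box `B = {μ ∈ 𝔡⁻¹ : 0 ≤ σ μ ≤ σ ν ∀ σ : F →+* ℝ}`, i.e. the antidiagonal is contained in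
`B ×ˢ B`.  The box is finite: in the integral-basis coordinates `e : 𝔡⁻¹ ≃ ℤ^ι`,
`e μ i = Tr(μ b_i) = ∑_σ σ(μ) σ(b_i)` (landed stubs `stub_dualLatticeEquiv` and
`stub_totallyReal_embeddings`), so `|e μ i| ≤ ∑_σ σ(ν) |σ(b_i)|` for `μ ∈ B`, and `e` embeds `B`
into a finite box of `ℤ^ι`.
-/

set_option linter.dupNamespace false

noncomputable section

namespace Summit.Langlands.Langlands.Theorems.HilbertIntegralOverconvergentIsCongruence

open NumberField
open Literature.NumberTheory.Automorphic Literature.NumberTheory.Automorphic.HilbertModular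

/-- Elements of the `q`-expansion cone `qIndexSet F` (`0` or totally positive) are totally
non-negative. -/
theorem fqa_nonneg_of_mem_qIndexSet {F : Type} [Field F] [NumberField F] {μ : F}
    (hμ : μ ∈ qIndexSet F) (σ : F →+* ℝ) : 0 ≤ σ μ := by
  rcases hμ.2 with h | h
  · rw [h, map_zero]
  · exact (h σ).le

/-- In integral-basis coordinates `e : 𝔡⁻¹ ≃ ℤ^ι` of the dual lattice, the `i`-th coordinate of
`μ ∈ 𝔡⁻¹`, as a real number, is `∑_σ σ(μ) σ(b_i)` (sum over the real embeddings of the totally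
real field `F`). -/
theorem fqa_coord_eq_sum_embeddings (F : Type) [Field F] [NumberField F]
    [NumberField.IsTotallyReal F]
    (e : {ν : F | ∀ a : 𝓞 F, ∃ n : ℤ, Algebra.trace ℚ F (ν * a) = n} ≃
      (Module.Free.ChooseBasisIndex ℤ (𝓞 F) → ℤ))
    (he : ∀ (ν : {ν : F | ∀ a : 𝓞 F, ∃ n : ℤ, Algebra.trace ℚ F (ν * a) = n})
      (i : Module.Free.ChooseBasisIndex ℤ (𝓞 F)),
      ((e ν i : ℤ) : ℚ) = Algebra.trace ℚ F ((ν : F) * integralBasis F i))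
    (μ : {ν : F | ∀ a : 𝓞 F, ∃ n : ℤ, Algebra.trace ℚ F (ν * a) = n})
    (i : Module.Free.ChooseBasisIndex ℤ (𝓞 F)) :
    ((e μ i : ℤ) : ℝ) = ∑ σ : F →+* ℝ, σ (μ : F) * σ (integralBasis F i) := by
  have h := (stub_totallyReal_embeddings F).1 ((μ : F) * integralBasis F i)
  rw [← he μ i, eq_ratCast, Rat.cast_intCast] at h
  rw [← h]
  exact Finset.sum_congr rfl fun σ _ ↦ map_mul σ _ _

/-- The box `{μ ∈ 𝔡⁻¹ : 0 ≤ σ μ ≤ σ ν ∀ σ}` of dual-lattice elements squeezed between `0` and `ν`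
at every real embedding is finite: the coordinates `e μ i = ∑_σ σ(μ) σ(b_i)` of its elements are
integers bounded by `∑_σ σ(ν) |σ(b_i)|`. -/
theorem fqa_box_finite (F : Type) [Field F] [NumberField F] [NumberField.IsTotallyReal F] (ν : F) :
    {μ : F | (∀ a : 𝓞 F, ∃ n : ℤ, Algebra.trace ℚ F (μ * a) = n) ∧
      ∀ σ : F →+* ℝ, 0 ≤ σ μ ∧ σ μ ≤ σ ν}.Finite := by
  classical
  obtain ⟨e, he⟩ := stub_dualLatticeEquiv F
  -- an integer bound on each coordinate of the box
  obtain ⟨K, hK⟩ : ∃ K : Module.Free.ChooseBasisIndex ℤ (𝓞 F) → ℕ,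
      ∀ i, ∑ σ : F →+* ℝ, σ ν * |σ (integralBasis F i)| ≤ K i :=
    ⟨fun i ↦ ⌈∑ σ : F →+* ℝ, σ ν * |σ (integralBasis F i)|⌉₊, fun i ↦ Nat.le_ceil _⟩
  -- the finite target box in `ℤ^ι` and its (finite) preimage under `e`
  have hT : (Set.univ.pi fun i : Module.Free.ChooseBasisIndex ℤ (𝓞 F) ↦
      Set.Icc (-(K i : ℤ)) (K i)).Finite := Set.Finite.pi fun i ↦ Set.finite_Icc _ _
  refine ((hT.preimage_embedding e.toEmbedding).image Subtype.val).subset ?_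
  rintro μ ⟨hμD, hμσ⟩
  refine ⟨⟨μ, hμD⟩, ?_, rfl⟩
  simp only [Set.mem_preimage, Equiv.coe_toEmbedding, Set.mem_univ_pi, Set.mem_Icc]
  intro i
  rw [← abs_le]
  -- `|e μ i| ≤ ∑_σ σ(ν) |σ(b_i)| ≤ K i`
  have key : |((e ⟨μ, hμD⟩ i : ℤ) : ℝ)| ≤ ∑ σ : F →+* ℝ, σ ν * |σ (integralBasis F i)| := by
    rw [fqa_coord_eq_sum_embeddings F e he ⟨μ, hμD⟩ i]
    refine (Finset.abs_sum_le_sum_abs _ _).trans (Finset.sum_le_sum fun σ _ ↦ ?_)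
    rw [abs_mul, abs_of_nonneg (hμσ σ).1]
    exact mul_le_mul_of_nonneg_right (hμσ σ).2 (abs_nonneg _)
  have hle : ((|e ⟨μ, hμD⟩ i| : ℤ) : ℝ) ≤ ((K i : ℤ) : ℝ) := by
    rw [Int.cast_abs, Int.cast_natCast]
    exact key.trans (hK i)
  exact_mod_cast hle

/-- **stub O1 — `stub_finite_qIndex_antidiagonal`.** For `ν ∈ F`, only finitely many pairs
`(μ, μ')` of `q`-expansion indices (`HilbertModular.qIndexSet`: in the dual lattice, `0` or
totally positive) have `μ + μ' = ν` (both summands are squeezed between `0` and `ν` at every real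
embedding, and the dual lattice is discrete: finitely many lattice points in a box). [folklore] -/
theorem stub_finite_qIndex_antidiagonal (F : Type) [Field F] [NumberField F]
    [NumberField.IsTotallyReal F] (ν : F) :
    {μ : F × F | μ.1 ∈ qIndexSet F ∧ μ.2 ∈ qIndexSet F ∧ μ.1 + μ.2 = ν}.Finite := by
  refine ((fqa_box_finite F ν).prod (fqa_box_finite F ν)).subset ?_
  rintro ⟨μ, μ'⟩ ⟨hμ, hμ', hsum⟩
  have hσ : ∀ σ : F →+* ℝ, σ μ + σ μ' = σ ν := fun σ ↦ by rw [← map_add, hsum]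
  refine Set.mk_mem_prod ⟨hμ.1, fun σ ↦ ⟨fqa_nonneg_of_mem_qIndexSet hμ σ, ?_⟩⟩
    ⟨hμ'.1, fun σ ↦ ⟨fqa_nonneg_of_mem_qIndexSet hμ' σ, ?_⟩⟩
  · linarith [hσ σ, fqa_nonneg_of_mem_qIndexSet hμ' σ]
  · linarith [hσ σ, fqa_nonneg_of_mem_qIndexSet hμ σ]

end Summit.Langlands.Langlands.Theorems.HilbertIntegralOverconvergentIsCongruence

end
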